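import Summits.PneNP.PneNP.Theorems.ReslinSizeFromWidthPCDegreeGapPadding
import Literature.Computability.MetaComplexity.ResolutionWidthRealize
import Literature.Computability.MetaComplexity.LinearMapResolutionWidthProofs
import HarnessLib

/-!
# PneNP / ReslinSizeFromWidth — `Deg = Width + 1` at EVERY width

Helper file for the INPUT side of crux `ResLinSizeFromWidth` (stmt-PneNP-18932); continuation of
`ReslinSizeFromWidthPCDegreeGap.lean` (the 2-CNF `φ₅` with Res(⊕) width `2` and PC/`𝔽₂` degree `3`)
and `ReslinSizeFromWidthPCDegreeGapPadding.lean` (padding raises Ben-Sasson–Wigderson width by exactly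
one and keeps "uniform, distinct variables, clause determined by its variable set").  Iterating the
padding from `φ₅` (`gapFamily k`, width `k + 2`):

**Theorem** (`gapFamily_gap`, `forall_width_exists_pcDegree_eq_resLinWidth_succ`).  For every
`w ≥ 2` there is an unsatisfiable `w`-CNF `Φ_w` with a resolution refutation of width `≤ w`
(`⊢_w`, realized as a list refutation with `resWidth ≤ w` by `ResDerivable.exists_isResRefutation`),
hence a Res(⊕) refutation with `≤ w` linear literals and rank `≤ w` per line and
`minResLinWidth Φ_w = w`, whose clause polynomials have a PC/`𝔽₂` refutation of degree `w + 1` (the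
rail, `resLin_pcDegree_le_rank_succ`) and NO PC/F refutation of degree `≤ w` over ANY field
(`not_refutableInDegree_cnfPolys_of_uniform`).  So the `+1` of "PC degree `≤` resolution width
`+ 1`" and of "PC/`𝔽₂` degree `≤` Res(⊕) width `+ 1`" is attained at every width, and the displayed
`Deg(φ) ≤ Width(φ)` of Gryaznov–Ovcharov–Riazanov 2024 (Thm 7) fails at every width `≥ 2`.

References: as in `ReslinSizeFromWidthPCDegreeGap.lean`; E. Ben-Sasson, A. Wigderson, J. ACM 48
(2001), §2.3 (`F ⊢_w E`).
-/

noncomputable section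

namespace Summit.PneNP.PneNP.Theorems

-- `Summit.PneNP.PneNP` repeats a path component by design (summit = sub-problem); silence the linter.
set_option linter.dupNamespace false

namespace ResLinPC

open MvPolynomial Finset
open Literature.Computability.Complexity Literature.Computability.MetaComplexity
open Summit.PneNP.PneNP.Theorems.PolyCalc

/-! ### The family -/

/-- The family with its variable bound: `(Φ_k, B_k)`, `Φ_0 = φ₅`, `Φ_{k+1} = padCNF B_k Φ_k`,
`B_{k+1} = B_k + 2|Φ_k|`. -/
def gapFamilyAux : ℕ → CNF ℕ × ℕ
  | 0 => (phi5, 5)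
  | k + 1 => (padCNF (gapFamilyAux k).2 (gapFamilyAux k).1,
      (gapFamilyAux k).2 + 2 * (gapFamilyAux k).1.length)

/-- **The gap family**: `gapFamily k` is a `(k+2)`-uniform unsatisfiable CNF (`gapFamily 0 = φ₅`). -/
def gapFamily (k : ℕ) : CNF ℕ := (gapFamilyAux k).1

/-- The invariant of the family: uniform width `k + 2`, distinct variables per clause, variables
below the bound, clauses determined by their variable sets, and `⊢_{k+2} ∅`. -/
theorem gapFamily_invariant (k : ℕ) :
    (∀ C ∈ gapFamily k, C.length = k + 2) ∧ (∀ C ∈ gapFamily k, (C.map Prod.fst).Nodup) ∧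
      (∀ C ∈ gapFamily k, ∀ l ∈ C, l.1 < (gapFamilyAux k).2) ∧
      (∀ C ∈ gapFamily k, ∀ D ∈ gapFamily k,
        (C.map Prod.fst).toFinset = (D.map Prod.fst).toFinset → C = D) ∧
      ResDerivable (clauseSet (gapFamily k)) (k + 2) ∅ := by
  induction k with
  | zero =>
    refine ⟨phi5_length, phi5_nodup, by decide, phi5_distinct, ?_⟩
    have h := resDerivable_empty_of_isResRefutation isResRefutation_phi5Res
    rwa [resWidth_phi5Res] at h
  | succ k ih =>
    obtain ⟨hlen, hnd, hB, -, hder⟩ := ih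
    have e : gapFamily (k + 1) = padCNF (gapFamilyAux k).2 (gapFamily k) := rfl
    have eB : (gapFamilyAux (k + 1)).2 = (gapFamilyAux k).2 + 2 * (gapFamily k).length := rfl
    refine ⟨?_, ?_, ?_, ?_, ?_⟩
    · intro P hP
      rw [e] at hP
      obtain ⟨i, hi, hP⟩ := mem_padCNF_iff.1 hP
      exact length_of_mem_padTriple (hlen _ (List.getElem_mem hi)) (by omega) hP
    · intro P hP
      rw [e] at hP
      obtain ⟨i, hi, hP⟩ := mem_padCNF_iff.1 hP
      exact nodup_of_mem_padTriple (hnd _ (List.getElem_mem hi)) (hB _ (List.getElem_mem hi)) hP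
    · intro P hP
      rw [e] at hP
      rw [eB]
      obtain ⟨i, hi, hP⟩ := mem_padCNF_iff.1 hP
      exact lt_of_mem_padTriple hi (hB _ (List.getElem_mem hi)) hP
    · intro P hP Q hQ hPQ
      rw [e] at hP hQ
      exact eq_of_varset_eq_padCNF hB hP hQ hPQ
    · rw [e]
      exact resDerivable_padCNF (by omega) hlen hder

/-! ### The gap at every width -/

/-- **`Deg ≥ w + 1` for `gapFamily k` (`w = k + 2`), over every field.** -/
theorem not_refutableInDegree_gapFamily (K : Type*) [Field K] (k : ℕ) :
    ¬ PC.RefutableInDegree (cnfPolys K (gapFamily k)) (k + 2) := by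
  obtain ⟨hlen, hnd, -, hdist, -⟩ := gapFamily_invariant k
  exact not_refutableInDegree_cnfPolys_of_uniform K (by omega) hlen hnd hdist

/-- **Resolution width `≤ w`**: `gapFamily k` has a resolution refutation of width `≤ k + 2`. -/
theorem exists_isResRefutation_gapFamily (k : ℕ) :
    ∃ π : List (ResLine ℕ), IsResRefutation (gapFamily k) π ∧ resWidth π ≤ k + 2 :=
  (gapFamily_invariant k).2.2.2.2.exists_isResRefutation

/-- **Res(⊕) width `≤ w`** (literal count and rank). -/
theorem exists_isResLinRefutation_gapFamily (k : ℕ) :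
    ∃ π : List ResLinLine, IsResLinRefutation (gapFamily k) π ∧ resLinWidth π ≤ k + 2 ∧
      ∀ l ∈ π, l.clause.card ≤ k + 2 := by
  obtain ⟨π, hπ, hw⟩ := exists_isResRefutation_gapFamily k
  exact exists_isResLinRefutation_of_resWidth_le hπ hw

/-- **`Deg ≤ w + 1`** (the rail). -/
theorem refutableInDegree_succ_gapFamily (k : ℕ) :
    PC.RefutableInDegree (cnfPolys (ZMod 2) (gapFamily k)) (k + 2 + 1) := by
  obtain ⟨π, hπ, hw, -⟩ := exists_isResLinRefutation_gapFamily k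
  exact resLin_pcDegree_le_rank_succ hπ hw fun c hc => by
    rw [(gapFamily_invariant k).1 c hc]; exact Nat.le_succ _

/-- **`minResLinWidth (gapFamily k) = k + 2`** (upper half: the refutation; lower half: the rail read
backwards from the degree lower bound). -/
theorem minResLinWidth_gapFamily (k : ℕ) : minResLinWidth (gapFamily k) = (k + 2 : ℕ) := by
  obtain ⟨π, hπ, hw, -⟩ := exists_isResLinRefutation_gapFamily k
  refine le_antisymm ((minResLinWidth_le hπ).trans (by exact_mod_cast hw)) ?_
  exact le_minResLinWidth_of_not_refutableInDegree (fun c hc => ((gapFamily_invariant k).1 c hc).le)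
    (not_refutableInDegree_gapFamily (ZMod 2) k)

/-- **The gap at width `k + 2`, all in one.** -/
theorem gapFamily_gap (k : ℕ) :
    (∀ C ∈ gapFamily k, C.length = k + 2) ∧
      (∃ π : List (ResLine ℕ), IsResRefutation (gapFamily k) π ∧ resWidth π ≤ k + 2) ∧
      minResLinWidth (gapFamily k) = (k + 2 : ℕ) ∧
      (∃ π : List ResLinLine, IsResLinRefutation (gapFamily k) π ∧ resLinWidth π ≤ k + 2 ∧
        ∀ l ∈ π, l.clause.card ≤ k + 2) ∧
      (∀ (K : Type) [Field K], ¬ PC.RefutableInDegree (cnfPolys K (gapFamily k)) (k + 2)) ∧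
      PC.RefutableInDegree (cnfPolys (ZMod 2) (gapFamily k)) (k + 2 + 1) :=
  ⟨(gapFamily_invariant k).1, exists_isResRefutation_gapFamily k, minResLinWidth_gapFamily k,
    exists_isResLinRefutation_gapFamily k, fun K _ => not_refutableInDegree_gapFamily K k,
    refutableInDegree_succ_gapFamily k⟩

end ResLinPC

open Literature.Computability.Complexity Literature.Computability.MetaComplexity
open Summit.PneNP.PneNP.Theorems.PolyCalc

/-- **Headline: `Deg = Width + 1` at every width.**  For every `w ≥ 2` there is a `w`-CNF `φ`
(`ResLinPC.gapFamily (w - 2)`) with a resolution refutation of width `≤ w`, minimal Res(⊕)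
rank-width exactly `w` (attained with `≤ w` linear literals per line), a PC/`𝔽₂` refutation of
degree `w + 1` and NO PC/F refutation of degree `≤ w` over any field `F`.  So the `+1` in
"PC degree `≤` resolution width `+ 1`" and in the tree's `Deg ≤ Width + 1`
(`resLin_pcDegree_le_rank_succ`) is attained at every width, and the displayed `Deg(φ) ≤ Width(φ)` of
[Gryaznov–Ovcharov–Riazanov 2024, Thm 7] fails at every width `≥ 2`. -/
theorem forall_width_exists_pcDegree_eq_resLinWidth_succ (w : ℕ) (hw : 2 ≤ w) :
    ∃ φ : CNF ℕ, (∀ C ∈ φ, C.length = w) ∧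
      (∃ π : List (ResLine ℕ), IsResRefutation φ π ∧ resWidth π ≤ w) ∧
      minResLinWidth φ = (w : ℕ) ∧
      (∃ π : List ResLinLine, IsResLinRefutation φ π ∧ resLinWidth π ≤ w ∧
        ∀ l ∈ π, l.clause.card ≤ w) ∧
      (∀ (K : Type) [Field K], ¬ PC.RefutableInDegree (cnfPolys K φ) w) ∧
      PC.RefutableInDegree (cnfPolys (ZMod 2) φ) (w + 1) := by
  obtain ⟨k, rfl⟩ : ∃ k, w = k + 2 := ⟨w - 2, by omega⟩
  exact ⟨ResLinPC.gapFamily k, ResLinPC.gapFamily_gap k⟩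

end Summit.PneNP.PneNP.Theorems
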